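import Summits.QuantumAdvantage.QuantumAdvantage.Theorems.LinnikCubicClassGroupsDegreeOnePrimesEscapeClassPNTSmoothedMain
import Summits.QuantumAdvantage.QuantumAdvantage.Theorems.LinnikCubicClassGroupsDegreeOnePrimesEscapeLowerPITSmoothedAux
import HarnessLib

/-!
# The trivial-zero and left-line terms of `ζ₁_E` WITHOUT the restriction `[E:ℚ] > 1`

Topic `Summits/QuantumAdvantage/QuantumAdvantage/Theorems`, cell B2b-1 (linnik-cubic), PART A (gen 13); helper
toward the crux `DegreeOnePrimesEscape` (stmt-QuantumAdvantage-11543) — removing the hypothesis `1 < [E:ℚ]`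
from the LMO chain for conjugacy classes (so that the case `⟨σ⟩ = Gal(N/ℚ)`, `E = N^{⟨σ⟩} = ℚ`, is covered).
HONEST FRAMING: the value of this file is a THEOREM (kernel-checked lemmas) — NOT summit progress.

The Deuring-twisted smoothed explicit formula (`deuringSum_core`, `…DeuringSmoothedCore.lean`) used
`1 < [E:ℚ]` only through `famMult_zero_term_le` and `leftLine_term_le_one`, whose proofs quoted
`condQn E ≥ 12`.  Both estimates hold for EVERY number field `E` (including degree `1`): the trivial-zero
bound only needs `condQn E ≥ 1` (`trivialZero_term_le_one_all`, `trivialZero_term_le_all`,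
`famMult_zero_term_le_all`), and the left-line bound only needs `L ≥ 8` in place of `condQn E ≥ 12`
(`leftLine_term_le_one_all`), which is automatic in the Linnik range (`L = log x ≥ 64`).
-/

noncomputable section

open Complex Real MeasureTheory Set Filter Topology
open scoped NumberField nonZeroDivisors
open Literature.NumberTheory.LFunctions Literature.NumberTheory.LFunctions.NumberField
  Literature.NumberTheory.LFunctions.EntireEF Literature.NumberTheory.LFunctions.TZWeight
  Literature.NumberTheory.LFunctions.AbelianDensity

namespace Summit.QuantumAdvantage.QuantumAdvantage.Theorems.DegreeOnePrimesEscape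

/-- `1 ≤ condQn K` for every number field. -/
theorem one_le_condQn_all (K : Type) [Field K] [NumberField K] : (1 : ℝ) ≤ ThornerZaman.condQn K := by
  obtain ⟨hlogd0, hlogd⟩ := log_natAbs_discr_mem K
  linarith

/-- The trivial zero of `ζ₁_K`, every `K`: `m₀ (L + ε) ≤ 1152 e^{L/4}` for `Q ≤ e^{L/8}`, `0 ≤ ε ≤ 1 ≤ L`. -/
theorem trivialZero_term_le_one_all (K : Type) [Field K] [NumberField K]
    {L ε : ℝ} (hL : 1 ≤ L) (hε0 : 0 ≤ ε) (hε1 : ε ≤ 1)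
    (hQexp : ThornerZaman.condQn K ≤ Real.exp (L / 8)) :
    (analyticOrderNatAt (dedekindZeta₁ K) 0 : ℝ) * (L + ε) ≤ 1152 * Real.exp (L / 4) := by
  set Q := ThornerZaman.condQn K with hQ
  have hQ1 : (1 : ℝ) ≤ Q := one_le_condQn_all K
  have hm₀ := analyticOrderNatAt_dedekindZeta₁_zero_le (K := K)
  obtain ⟨-, hlogd⟩ := log_natAbs_discr_mem K
  have hnQ : (Module.finrank ℚ K : ℝ) ≤ Q := ThornerZaman.finrank_le_condQn (K := K)
  have h1 : 8 * (Real.log ((NumberField.discr K).natAbs : ℝ) + 6 * Module.finrank ℚ K + 3) ≤ 72 * Q := by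
    rw [← hQ] at hlogd; linarith
  have h2 : L + ε ≤ 2 * L := by linarith
  have h3 : (analyticOrderNatAt (dedekindZeta₁ K) 0 : ℝ) * (L + ε) ≤ 72 * Q * (2 * L) :=
    mul_le_mul (hm₀.trans h1) h2 (by linarith) (by positivity)
  have hL8 := le_eight_mul_exp_div L
  have hee : Real.exp (L / 8) * Real.exp (L / 8) = Real.exp (L / 4) := by
    rw [← Real.exp_add]; ring_nf
  have h4 : Q * L ≤ Real.exp (L / 8) * (8 * Real.exp (L / 8)) :=
    mul_le_mul hQexp hL8 (by linarith) (Real.exp_pos _).le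
  nlinarith [Real.exp_pos (L / 8)]

/-- The trivial zero of `L(s, χ)`, `χ ≠ 1`, every `K`: `m_χ(0) (L + ε) ≤ 1152 e^{L/4}`. -/
theorem trivialZero_term_le_all (K : Type) [Field K] [NumberField K]
    {χ : ClassGroup (𝓞 K) →* ℂˣ} (hχ : χ ≠ 1) {L ε : ℝ} (hL : 1 ≤ L) (hε0 : 0 ≤ ε) (hε1 : ε ≤ 1)
    (hQexp : ThornerZaman.condQn K ≤ Real.exp (L / 8)) :
    (analyticOrderNatAt (classGroupLFunction₀ K χ) 0 : ℝ) * (L + ε) ≤ 1152 * Real.exp (L / 4) := by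
  set Q := ThornerZaman.condQn K with hQ
  have hQ1 : (1 : ℝ) ≤ Q := one_le_condQn_all K
  have hm₀ := analyticOrderNatAt_classGroupLFunction₀_zero_le (K := K) hχ
  obtain ⟨-, hlogd⟩ := log_natAbs_discr_mem K
  have hnQ : (Module.finrank ℚ K : ℝ) ≤ Q := ThornerZaman.finrank_le_condQn (K := K)
  have h1 : 8 * (Real.log ((NumberField.discr K).natAbs : ℝ) + 6 * Module.finrank ℚ K + 2) ≤ 72 * Q := by
    rw [← hQ] at hlogd; linarith
  have h2 : L + ε ≤ 2 * L := by linarith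
  have h3 : (analyticOrderNatAt (classGroupLFunction₀ K χ) 0 : ℝ) * (L + ε) ≤ 72 * Q * (2 * L) :=
    mul_le_mul (hm₀.trans h1) h2 (by linarith) (by positivity)
  have hL8 := le_eight_mul_exp_div L
  have hee : Real.exp (L / 8) * Real.exp (L / 8) = Real.exp (L / 4) := by
    rw [← Real.exp_add]; ring_nf
  have h4 : Q * L ≤ Real.exp (L / 8) * (8 * Real.exp (L / 8)) :=
    mul_le_mul hQexp hL8 (by linarith) (Real.exp_pos _).le
  nlinarith [Real.exp_pos (L / 8)]

/-- The trivial-zero term of every member of the class-group family, every `K`: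
`m_ψ(0)(L + ε) ≤ 1152 e^{L/4}` (`Q ≤ e^{L/8}`, `0 ≤ ε ≤ 1 ≤ L`). -/
theorem famMult_zero_term_le_all (K : Type) [Field K] [NumberField K]
    (ψ : AddChar (Additive (ClassGroup (𝓞 K))) ℂ)
    {L ε : ℝ} (hL : 1 ≤ L) (hε0 : 0 ≤ ε) (hε1 : ε ≤ 1) (hQexp : ThornerZaman.condQn K ≤ Real.exp (L / 8)) :
    (famMult K ψ 0 : ℝ) * (L + ε) ≤ 1152 * Real.exp (L / 4) := by
  by_cases hψ : ψ = 0
  · subst hψ; rw [famMult, famF_zero]; exact trivialZero_term_le_one_all K hL hε0 hε1 hQexp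
  · rw [famMult, famF_of_ne hψ]; exact trivialZero_term_le_all K (toHomUnits_ne_one hψ) hL hε0 hε1 hQexp

/-- The left-line integral for `ζ_K`, every `K` (the hypothesis `[K:ℚ] > 1` of `leftLine_term_le_one` is
replaced by `L ≥ 8`): `‖J₁(0)‖ ≤ 8 · leftLineConst · Al (n + 1) M` for `g = tzTest L ε`, `ε = e^{−νL}`,
`ν ≤ 1/64`, `Q ≤ e^{L/8}`, `0 < ε < L/2`, `ε ≤ 1`. -/
theorem leftLine_term_le_one_all {Al : ℝ} (hAl0 : 0 < Al)
    (hAl : ∀ (K : Type) [Field K] [NumberField K] (χ : ClassGroup (𝓞 K) →* ℂˣ) (t : ℝ),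
      ‖logDeriv (classGroupLFunction K χ) (-1 / 2 + t * I)‖ ≤
        Al * (Module.finrank ℚ K + 1) * (Real.log ((NumberField.discr K).natAbs : ℝ) + Real.log (|t| + 4)))
    {M : ℝ} (hM : ∀ y : ℝ, |iteratedDeriv 1 Real.smoothTransition y| ≤ M ∧
      |iteratedDeriv 2 Real.smoothTransition y| ≤ M)
    (K : Type) [Field K] [NumberField K]
    {L ε ν : ℝ} (hL : 8 ≤ L) (hε : 0 < ε) (hεL : ε < L / 2)
    (hε1 : ε ≤ 1) (hν64 : ν ≤ 1 / 64) (hεexp : ε = Real.exp (-(ν * L)))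
    (hQexp : ThornerZaman.condQn K ≤ Real.exp (L / 8)) :
    ‖dzEFRemainder K (tzTest L ε) 0‖ ≤ 8 * leftLineConst * Al * (Module.finrank ℚ K + 1) * M := by
  have hL0 : 0 < L := by linarith
  have hJ := norm_dzEFRemainder_tzTest_zero_le (K := K) hAl0 hAl hM hL0 hε hεL
  have hM0 : 0 ≤ M := le_trans (abs_nonneg _) (hM 0).1
  have hlC := leftLineConst_nonneg
  set Q := ThornerZaman.condQn K with hQ
  obtain ⟨hlogd0, hlogd⟩ := log_natAbs_discr_mem K
  -- `e^{L/8} ≥ 1 + L/8 ≥ 2`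
  have hexp8 : (2 : ℝ) ≤ Real.exp (L / 8) := by
    have := Real.add_one_le_exp (L / 8); linarith
  have hlogd4 : Real.log ((NumberField.discr K).natAbs : ℝ) + Real.log 4 + 1 ≤ 2 * Real.exp (L / 8) := by
    have hlog4 : Real.log 4 ≤ 2 := by
      have : Real.log 4 = 2 * Real.log 2 := by
        rw [show (4:ℝ) = 2 ^ 2 by norm_num, Real.log_pow]; norm_num
      rw [this]; have := Real.log_two_lt_d9; linarith
    rw [← hQ] at hlogd; linarith
  have hexp1 : Real.exp (-(L / 4) + ε / 2) ≤ 2 * Real.exp (-(L / 4)) := by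
    rw [Real.exp_add, mul_comm]
    refine mul_le_mul_of_nonneg_right ?_ (Real.exp_pos _).le
    have hsq : Real.exp (ε / 2) ^ 2 < 2 ^ 2 := by
      rw [← Real.exp_nat_mul]
      have h1 : Real.exp ((2 : ℕ) * (ε / 2)) ≤ Real.exp 1 := Real.exp_le_exp.2 (by push_cast; linarith)
      have := Real.exp_one_lt_d9; linarith
    exact (lt_of_pow_lt_pow_left₀ 2 (by norm_num) hsq).le
  have hexp2 : 2 * M / ε ≤ 2 * M * Real.exp (L / 64) := by
    rw [hεexp, div_eq_mul_inv, ← Real.exp_neg, neg_neg]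
    refine mul_le_mul_of_nonneg_left (Real.exp_le_exp.2 ?_) (by positivity)
    nlinarith
  have hlog40 : 0 ≤ Real.log 4 := Real.log_nonneg (by norm_num)
  have hprod : (Real.log ((NumberField.discr K).natAbs : ℝ) + Real.log 4 + 1) *
      (Real.exp (-(L / 4) + ε / 2) * (2 * M / ε)) ≤ 8 * M := by
    calc (Real.log ((NumberField.discr K).natAbs : ℝ) + Real.log 4 + 1) *
          (Real.exp (-(L / 4) + ε / 2) * (2 * M / ε))
        ≤ (2 * Real.exp (L / 8)) * ((2 * Real.exp (-(L / 4))) * (2 * M * Real.exp (L / 64))) :=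
          mul_le_mul hlogd4 (mul_le_mul hexp1 hexp2 (by positivity) (by positivity))
            (by positivity) (by positivity)
      _ = 8 * M * Real.exp (L / 8 + -(L / 4) + L / 64) := by
          rw [Real.exp_add, Real.exp_add]; ring
      _ ≤ 8 * M * 1 := by
          refine mul_le_mul_of_nonneg_left ?_ (by positivity)
          rw [Real.exp_le_one_iff]; nlinarith
      _ = 8 * M := mul_one _
  refine hJ.trans ?_
  rw [mul_assoc (leftLineConst * (Al * ((Module.finrank ℚ K : ℝ) + 1)))]
  calc leftLineConst * (Al * ((Module.finrank ℚ K : ℝ) + 1)) *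
        ((Real.log ((NumberField.discr K).natAbs : ℝ) + Real.log 4 + 1) *
          (Real.exp (-(L / 4) + ε / 2) * (2 * M / ε)))
      ≤ leftLineConst * (Al * ((Module.finrank ℚ K : ℝ) + 1)) * (8 * M) :=
        mul_le_mul_of_nonneg_left hprod (by positivity)
    _ = _ := by ring

end Summit.QuantumAdvantage.QuantumAdvantage.Theorems.DegreeOnePrimesEscape
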